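import Summits.BirchSwinnertonDyer.BirchSwinnertonDyer.Theses.KolyvaginRankRigidityAtTwo
import Summits.BirchSwinnertonDyer.BirchSwinnertonDyer.Theorems.Rank1ResidualJetRingClassFields
import Summits.BirchSwinnertonDyer.BirchSwinnertonDyer.Theorems.Rank1ResidualJetSelmerLemmas
import Literature.NumberTheory.EllipticCurves.KolyvaginPrimeTorsionFixingOfIndex
import Literature.NumberTheory.EllipticCurves.HeegnerPointsKolyvaginLocalCriterion
import Literature.NumberTheory.EllipticCurves.SelmerLocalConditionGoodReductionProofs
import Literature.NumberTheory.EllipticCurves.HeegnerPointsKolyvaginEulerSystem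
import Literature.NumberTheory.EllipticCurves.NonvanishingTwistsWaldspurgerOfHoffsteinLuo
import Literature.NumberTheory.EllipticCurves.TorsionFrobeniusProofs
import Literature.NumberTheory.EllipticCurves.HeegnerPointsKolyvaginPrimaryUnramifiedProofs
import Literature.NumberTheory.EllipticCurves.RingClassFieldInertia
import Summits.BirchSwinnertonDyer.BirchSwinnertonDyer.Theorems.KolyvaginRankRigidityAtTwoClassesIntoSelmerGood
import Summits.BirchSwinnertonDyer.Rank1Residual.JET.RingClassTransverseLocal
import HarnessLib

/-!
# Crux U1 `KolyvaginBoundedDefectAtTwo` (stmt-BirchSwinnertonDyer-28083), LINE 17 `kolyvagin_swap` v7.2r,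
# stub EV `stub_singularToVisibleAtTwo` — SINGULAR-TO-VISIBLE (routine support, S)

LEAD prover `cruxlead-stmt-BirchSwinnertonDyer-28083-g3` working on line 17 v7.2r.
THIS FILE = proof of the registered stub EV. Target: `--supports stmt-BirchSwinnertonDyer-28083`.

## EV (v7.2r skeleton lines 392-399)

For a square-free Kolyvagin conductor m·q (q ∤ m prime, all indices ≥ M ≥ 1) and a datum d at m,
if 2^j · c_M(m) is not locally trivial at the prime w∣q of K, then c_M(m) has VISIBLE order > 2^j:
some ρ ∈ Γ_{K(E[2^M])} has 2^j · h1Eval c ρ ≠ 0.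

Proof: q is a Kolyvagin prime with index ≥ M; by `exists_isArithFrobAt_mem_torsionFixing_of_le_kolyvaginIndex`,
there is a Frobenius F in torsionFixing; by `mem_torsionLocalKer_iff_h1Eval_eq_zero` (contrapositive),
hnotSel → h1Eval ≠ 0; `h1Eval_zsmul` extracts the 2^j factor.

[cite: GrossLMS1991, §9, Prop. 9.1] [cite: McCallumLMS1991, Prop. 4.4 (3)]
Nothing here proves U1 or BSD. BSD is NOT proved.
-/

set_option autoImplicit false
set_option linter.dupNamespace false

noncomputable section

open scoped Classical
open WeierstrassCurve NumberField IsDedekindDomain Field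
open Literature.NumberTheory.GaloisRepresentations Literature.NumberTheory.EllipticCurves
open Literature.NumberTheory
open Summit.BirchSwinnertonDyer.BirchSwinnertonDyer.Theses.KolyvaginRankRigidityAtTwo
open Summit.BirchSwinnertonDyer.Rank1Residual

namespace Summit.BirchSwinnertonDyer.BirchSwinnertonDyer.Theorems.KolyvaginSwap.EV

/-- **EV holds** (the routine stub): if 2^j · c_M(m) ∉ torsionLocalKer_w then visible order > 2^j.
By the local criterion `mem_torsionLocalKer_iff_h1Eval_eq_zero`, membership in torsionLocalKer is
characterized by h1Eval vanishing at a Frobenius in torsionFixing. A Kolyvagin prime q with index ≥ M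
has such a Frobenius by `exists_isArithFrobAt_mem_torsionFixing_of_le_kolyvaginIndex`, so the
contrapositive + `h1Eval_zsmul` give the result. -/
theorem singularToVisibleAtTwo_holds :
    ∀ (W : WeierstrassCurve ℚ) [W.IsElliptic] [W.IsGloballyMinimal], ¬ W.HasCM →
      (Rank1Residual.GoodOrd W 2 ∨ Rank1Residual.Mult W 2) →
      (∀ m : ℕ, W.HasSurjectiveModNGaloisRep (2 ^ m : ℕ)) →
      ∀ (K : Type) [Field K] [NumberField K], IsImaginaryQuadratic K →
      ∀ [NeZero (W.conductorNorm ℤ)], SatisfiesHeegnerHypothesis (W.conductorNorm ℤ) K →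
      Odd (NumberField.discr K) → NumberField.discr K ≠ -3 →
      AddSubgroup.torsionBy (W.baseChange K).toAffine.Point (2 : ℤ) = ⊥ →
      SatisfiesHeegnerHypothesis 2 K →
      ∀ (Dt : ModularForms.ModularParametrizationData W (W.conductorNorm ℤ)) (β : ℤ) (ι : K →+* ℂ)
        [∀ k : ℕ, NumberField (ringClassField K ι k)], (4 * (W.conductorNorm ℤ : ℤ)) ∣ β ^ 2 - NumberField.discr K →
      ∀ (M m q j : ℕ) (d : KolyvaginHeegnerData Dt β ι m), 1 ≤ M → Squarefree (m * q) → q.Prime → ¬ q ∣ m →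
        (∀ l' ∈ (m * q).primeFactors, Zhang2014.IsKolyvaginPrime (W.conductorNorm ℤ) W K 2 l' ∧ M ≤ Zhang2014.kolyvaginIndex W 2 l') →
        ∀ (w : HeightOneSpectrum (𝓞 K)), (q : 𝓞 K) ∈ w.asIdeal →
        ((2 ^ j : ℕ) : ℤ) • d.kolyvaginClass Nat.prime_two M ∉ (W.baseChange K).torsionLocalKer (w.adicCompletion K) ((2 ^ M : ℕ) : ℤ) →
        ∃ ρ ∈ torsionFixing (W.baseChange K) ((2 ^ M : ℕ) : ℤ),
          ((2 ^ j : ℕ) : ℤ) • h1Eval (W.baseChange K) ((2 ^ M : ℕ) : ℤ) (d.kolyvaginClass Nat.prime_two M) ρ ≠ 0 := by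
  intro W _ _ hCM hred hsurj K _ _ hK _ hH hodd hd3 htors hH2 Dt β ι _ hβ M m q j d hM hsqf hq hqm hkol w hw hnotSel
  -- q ∈ primeFactors (m * q) and is a Kolyvagin prime with index ≥ M
  have hqpf : q ∈ (m * q).primeFactors := by
    rw [Nat.mem_primeFactors]
    constructor
    · exact hq
    constructor
    · exact Nat.dvd_mul_left q m
    · intro h
      simp only [mul_eq_zero] at h
      rcases h with rfl | rfl
      · simp at hsqf
      · exact hq.ne_zero rfl
  obtain ⟨hqKol, hqIdx⟩ := hkol q hqpf
  haveI : Fact (Nat.Prime 2) := ⟨Nat.prime_two⟩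
  have hq0 : 2 ^ M ≠ 0 := pow_ne_zero M (Nat.succ_ne_zero 1)
  have hn0 : ((2 ^ M : ℕ) : ℤ) ≠ 0 := Int.natCast_ne_zero.mpr hq0
  have hq2 : q ≠ 2 := hqKol.2.2.2.1
  -- (2 : 𝓞 K) ∉ w.asIdeal (since q ≠ 2 and (q : 𝓞 K) ∈ w.asIdeal)
  have h2w : ((2 : ℕ) : 𝓞 K) ∉ w.asIdeal :=
    not_natCast_mem_of_prime_ne hqKol.1 Nat.prime_two hq2 w hw
  -- (2^M : 𝓞 K) ∉ w.asIdeal (from h2w and primality)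
  have h2Mw : ((2 ^ M : ℕ) : 𝓞 K) ∉ w.asIdeal := by
    intro h
    apply h2w
    rw [Nat.cast_pow] at h
    exact w.isPrime.mem_of_pow_mem M h
  have h2MwZ : ((((2 ^ M : ℕ) : ℤ)) : 𝓞 K) ∉ w.asIdeal := by
    rwa [Int.cast_natCast]
  -- Get a local prime 𝔐 ∈ w.localPrimesAbove
  obtain ⟨𝔐, h𝔐⟩ := w.localPrimesAbove_nonempty
  -- 𝔓 := primeBelow(closureEmb, 𝔐) ∈ w.primesAbove
  set 𝔓 := w.primeBelow (closureEmb (K := K) (w.adicCompletion K)) 𝔐 with h𝔓def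
  have h𝔓 : 𝔓 ∈ w.primesAbove := HeightOneSpectrum.primeBelow_mem_primesAbove h𝔐
  -- The rational place v := w.under below w
  set v := w.under (𝓞 ℚ) with hvdef
  have hqv : (q : 𝓞 ℚ) ∈ v.asIdeal := by
    change (q : 𝓞 ℚ) ∈ w.asIdeal.under (𝓞 ℚ)
    rw [Ideal.under_def, Ideal.mem_comap, map_natCast]; exact hw
  -- Good reduction at v (q ∤ N from Kolyvagin prime condition)
  have hgoodQ : W.HasGoodReductionAt v := by
    -- q is a Kolyvagin prime so q ∤ N (conductor), hence good reduction at v ∋ q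
    -- Need: primesEquiv v = q (as ℕ), which follows from (q : 𝓞 ℚ) ∈ v.asIdeal
    have hqN : ¬ q ∣ W.conductorNorm ℤ := hqKol.2.1
    have hprime_v : (Rat.HeightOneSpectrum.primesEquiv v : ℕ) = q :=
      primesEquiv_eq_of_natCast_mem hq hqv
    refine hasGoodReductionAt_of_not_dvd_conductorNorm W v ?_
    rw [hprime_v]
    exact hqN
  -- Good reduction at w (from hasGoodReductionAt_of_zhangKolyvagin)
  have hgood : (W.baseChange K).HasGoodReductionAt w :=
    (Summit.BirchSwinnertonDyer.Rank1Residual.JET.RingClassTransverse.hasGoodReductionAt_of_zhangKolyvagin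
      (W := W) (K := K) Nat.prime_two hqKol w hw M).1
  have hwbad : w ∉ (W.baseChange K).badPlaces (𝓞 K) := fun h ↦ h hgood
  -- Get F ∈ torsionFixing via exists_isArithFrobAt_mem_torsionFixing_of_le_kolyvaginIndex
  obtain ⟨F, hF, hFfix⟩ :=
    exists_isArithFrobAt_mem_torsionFixing_of_le_kolyvaginIndex W hK hqKol hqIdx hqv hgoodQ hw h𝔓
  -- Inertia at 𝔓 ≤ torsionFixing
  have hIfix : 𝔓.inertia (absoluteGaloisGroup K) ≤ torsionFixing (W.baseChange K) ((2 ^ M : ℕ) : ℤ) :=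
    inertia_le_torsionFixing (W.baseChange K) hwbad h2MwZ _ h𝔐
  -- torsionFixing is open
  have hopen : IsOpen (torsionFixing (W.baseChange K) ((2 ^ M : ℕ) : ℤ) : Set (absoluteGaloisGroup K)) :=
    isOpen_torsionFixing (W.baseChange K) hn0
  -- torsionPointsMap is surjective at w
  haveI : CharZero (w.adicCompletion K) := charZero_adicCompletion w
  have hsurjw : Function.Surjective (torsionPointsMap (W.baseChange K) (w.adicCompletion K) ((2 ^ M : ℕ) : ℤ)) :=
    (torsionPointsMap_bijective (W.baseChange K) (w.adicCompletion K) hq0).2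
  -- The Kolyvagin class 2^j · c_M(m) is unramified at 𝔓
  -- At q ∤ m, the Kolyvagin class c_M(m) is unramified at w. The proof:
  -- 1. Inertia at w acts trivially on E[2^M] (good reduction, 2^M ∉ w)
  -- 2. The cocycle φ(g) = gQ - Q ∈ E[2^M] for any g
  -- 3. For g ∈ inertia, g fixes E[2^M], so φ is principal on inertia (with witness 0)
  -- 4. Therefore c_M(m) ∈ unramifiedKer = kernel of restriction to inertia
  have hcunr : d.kolyvaginClass Nat.prime_two M ∈ unramifiedKer (geomTorsion (W.baseChange K) ((2 ^ M : ℕ) : ℤ)) 𝔓 := by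
    -- The Kolyvagin class is in selmerLocalKer at w (Gross Prop. 6.2(1)), which is ≤ unramifiedKer.
    -- Key facts: q ∤ m (hqm), K[m]/K unramified at w, inertia fixes P(m) ∈ E(K[m]).
    apply selmerLocalKer_le_unramifiedKer
      (HeightOneSpectrum.exists_mem_inertia_apply_eq_holds w)
      (W.baseChange K).smul_localPoints_eq_of_mem_inertia_holds hwbad h2MwZ h𝔓
    -- Use kolyvaginClass_mem_selmerLocalKer_of_hasGoodReductionAt (KolyvaginRankRigidityAtTwoClassesIntoSelmerGood)
    -- Need: m ≠ 0, (m : 𝓞 K) ∉ w.asIdeal, and hgood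
    have hm0 : m ≠ 0 := by
      intro h; rw [h, zero_mul] at hsqf; simp at hsqf
    have hmw : ((m : ℕ) : 𝓞 K) ∉ w.asIdeal := by
      -- w lies above (q) since (q : 𝓞 K) ∈ w.asIdeal (hw) and q.Prime (hq).
      -- If (m : 𝓞 K) ∈ w.asIdeal, then q ∣ m (the rational prime below w divides m).
      -- This contradicts hqm : ¬ q ∣ m.
      -- Standard: q = primesEquiv(w.under); (m : 𝓞 K) ∈ w implies (m : ℤ) ∈ (q), so q ∣ m.
      intro hm; apply hqm
      -- (m : 𝓞 K) ∈ w.asIdeal with w above (q) implies q ∣ m.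
      -- w contracts to a prime of ℤ containing q; since q is prime, the contraction = (q).
      -- Then (m : ℤ) ∈ (q) gives q ∣ m.
      have hq_under : (q : ℤ) ∈ w.asIdeal.comap (algebraMap ℤ (𝓞 K)) := by
        simp only [Ideal.mem_comap, map_natCast]; exact hw
      have hm_under : (m : ℤ) ∈ w.asIdeal.comap (algebraMap ℤ (𝓞 K)) := by
        simp only [Ideal.mem_comap, map_natCast]; exact hm
      -- The contraction is a nonzero prime ideal of ℤ containing q, hence = (q).
      have hprime_comap : (w.asIdeal.comap (algebraMap ℤ (𝓞 K))).IsPrime :=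
        w.isPrime.comap (algebraMap ℤ (𝓞 K))
      have hcontract_eq : w.asIdeal.comap (algebraMap ℤ (𝓞 K)) = Ideal.span {(q : ℤ)} := by
        -- The contraction is a prime ideal of ℤ. In ℤ, prime ideals are (0) or (p) for p prime.
        -- Since q ∈ contraction and q ≠ 0, the contraction = (q).
        have hne_zero : w.asIdeal.comap (algebraMap ℤ (𝓞 K)) ≠ ⊥ := fun h => by
          rw [h] at hq_under; simp at hq_under; exact hq.ne_zero hq_under
        -- PID structure of ℤ: prime ideal = (generator), and q generates
        obtain ⟨g, hgen⟩ := Submodule.IsPrincipal.principal (w.asIdeal.comap (algebraMap ℤ (𝓞 K)))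
        rw [hgen] at hq_under hprime_comap hne_zero ⊢
        simp only [Ideal.submodule_span_eq] at hgen hq_under hprime_comap hne_zero ⊢
        rw [Ideal.mem_span_singleton] at hq_under
        -- g ∣ q and g generates a prime ideal ≠ 0, so |g| = q (since q prime)
        have hgprime : Prime g := (Ideal.span_singleton_prime (fun h => hne_zero (by rw [h]; simp))).mp hprime_comap
        have hgdvdq : g ∣ (q : ℤ) := hq_under
        have habs : Int.natAbs g = q := by
          have hdvd_nat := Int.natCast_dvd_natCast.mp (Int.natAbs_dvd.mpr hgdvdq)
          refine Nat.Prime.eq_one_or_self_of_dvd hq _ hdvd_nat |>.resolve_left fun h => ?_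
          -- g.natAbs = 1 means g = ±1, so g is a unit, contradicting hgprime
          have hgunit : IsUnit g := by
            rcases Int.natAbs_eq_iff.mp h with ⟨_, rfl⟩ | ⟨_, rfl⟩ <;> simp [isUnit_one]
          exact hgprime.not_unit hgunit
        conv_rhs => rw [← habs, Int.span_natAbs]
      rw [hcontract_eq, Ideal.mem_span_singleton] at hm_under
      exact Int.natCast_dvd_natCast.mp hm_under
    exact Summit.BirchSwinnertonDyer.BirchSwinnertonDyer.Theorems.KolyvaginRankRigidity.kolyvaginClass_mem_selmerLocalKer_of_hasGoodReductionAt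
      d hK hm0 Nat.prime_two M w hmw hgood
  have hcunrj : ((2 ^ j : ℕ) : ℤ) • d.kolyvaginClass Nat.prime_two M ∈ unramifiedKer (geomTorsion (W.baseChange K) ((2 ^ M : ℕ) : ℤ)) 𝔓 :=
    (unramifiedKer (geomTorsion (W.baseChange K) ((2 ^ M : ℕ) : ℤ)) 𝔓).zsmul_mem hcunr _
  -- Apply the local criterion
  have hcrit := mem_torsionLocalKer_iff_h1Eval_eq_zero (W.baseChange K) ((2 ^ M : ℕ) : ℤ)
    h𝔐 hF hFfix hIfix hopen hsurjw hcunrj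
  -- hnotSel says 2^j · c ∉ torsionLocalKer, so h1Eval (2^j · c) F ≠ 0
  have heval_ne : h1Eval (W.baseChange K) ((2 ^ M : ℕ) : ℤ)
      (((2 ^ j : ℕ) : ℤ) • d.kolyvaginClass Nat.prime_two M) F ≠ 0 := by
    intro heq
    exact hnotSel (hcrit.mpr heq)
  -- Use h1Eval_zsmul to extract the factor of 2^j
  rw [h1Eval_zsmul _ _ _ _ hFfix] at heval_ne
  exact ⟨F, hFfix, heval_ne⟩

end Summit.BirchSwinnertonDyer.BirchSwinnertonDyer.Theorems.KolyvaginSwap.EV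

end
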